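import Literature.NumberTheory.EllipticCurves.HidaFamilyMembersProofs
import HarnessLib

/-!
# Congruent newforms in higher weight through an arbitrary multiplier `≡ 1 (mod 𝔪)` (proofs only)

Topic `Literature/NumberTheory/EllipticCurves`; namespace
`Literature.NumberTheory.EllipticCurves.ModularForms`.  THEOREMS ONLY (no definition, no named
fact; D-0026).  A companion of `HidaFamilyMembersProofs.lean`, whose theorem
`exists_isNewform0_dvd_level_congr` (Deligne–Serre 1974, 6.9–6.11 + Atkin–Lehner–Li) produces, for
a newform `f ∈ S_{k₀}(Γ₀(N))`, any prime `p` and any EVEN `w ≥ 3` with `(p − 1) ∣ w`, a newform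
`g ∈ S_{k₀+w}(Γ₀(M))`, `M ∣ N`, congruent to `f` modulo `𝔪_{ℚ̄_p}` away from `N`, by lifting the
mod-`𝔪` Hecke eigenvector `f · E_w` (`E_w` the LEVEL-ONE Eisenstein series, `E_w ≡ 1 (mod p)` by
von Staudt–Clausen).  The restriction `w ≥ 3` is only there because `E_2` is not a modular form; the
argument itself uses nothing about `E_w` beyond

* `E_w` is a modular form of weight `w` on `Γ₁(N)` invariant under all of `Γ₀(N)` (so that `f · E_w`
  has trivial nebentypus), and
* its `q`-expansion is `≡ 1 (mod 𝔪)`: constant term `1`, all other coefficients in `𝔪_{ℚ̄_p}`.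

This file RE-RUNS the Deligne–Serre step of `HidaFamilyMembersProofs.lean` with `E_w` replaced by an
ARBITRARY such multiplier `E ∈ M_w(Γ₁(N))`, `(p − 1) ∣ w`:

* `diamondOp_mulModularForm_of_forall_slash_eq` — `⟨d⟩ (f E) = (⟨d⟩ f) E` on `S_k(Γ₁(N))` for a
  `Γ₀(N)`-invariant `E ∈ M_w(Γ₁(N))` (the tree has the level-one and the `χ₋₄` versions);
* `exists_isNewform0_dvd_level_congr_of_multiplier` — the congruent newform `g ∈ S_{k₀+w}(Γ₀(M))`,
  `M ∣ N` (the tree's proof, verbatim up to the three lines that touch `E`).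

The weight-two multiplier `(E₂(τ) − M E₂(Mτ))/(1 − M)` at `p ∣ 24` and the resulting congruent
newforms of weight `k₀ + 2` at `p = 3` are in `CongruentNewformWeightTwoMultiplierProofs.lean`.

## References

* P. Deligne, J.-P. Serre, *Formes modulaires de poids 1*, Ann. Sci. ÉNS (4) 7 (1974), 507–530,
  6.9–6.11. [DeligneSerreASENS1974]
* F. Diamond, J. Shurman, *A First Course in Modular Forms*, GTM 228 (2005), §5.2 (diamond
  operators), Thm. 5.8.2–5.8.3 (Atkin–Lehner–Li). [DiamondShurman2005]
-/

noncomputable section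

open scoped MatrixGroups ModularForm Manifold
open CongruenceSubgroup UpperHalfPlane

namespace Literature.NumberTheory.EllipticCurves.ModularForms

/-! ### Norm bookkeeping in `ℚ̄_p` (private copies of the lemmas of `HidaFamilyMembersProofs`) -/

section Norm

variable {p : ℕ} [Fact p.Prime]

/-- Chaining two congruences modulo `𝔪`. [folklore] -/
private theorem mult_norm_sub_lt_one_trans {x y z : PadicAlgCl p} (h₁ : ‖x - y‖ < 1)
    (h₂ : ‖y - z‖ < 1) : ‖x - z‖ < 1 := by
  have : x - z = (x - y) + (y - z) := by ring
  rw [this]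
  exact (PadicAlgCl.isNonarchimedean p _ _).trans_lt (max_lt h₁ h₂)

/-- Ultrametric inequality for differences. [folklore] -/
private theorem mult_norm_sub_le_maxAux (x y : PadicAlgCl p) : ‖x - y‖ ≤ max ‖x‖ ‖y‖ := by
  have h := PadicAlgCl.isNonarchimedean p x (-y)
  rwa [norm_neg, ← sub_eq_add_neg] at h

/-- An element congruent to an element of norm `1` has norm `1`. [folklore] -/
private theorem mult_norm_eq_one_of_norm_sub_lt_one {x y : PadicAlgCl p} (hy : ‖y‖ = 1)
    (h : ‖x - y‖ < 1) : ‖x‖ = 1 := by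
  apply le_antisymm
  · have h1 : x = (x - y) + y := by ring
    rw [h1]
    exact (PadicAlgCl.isNonarchimedean p _ _).trans (max_le h.le hy.le)
  · by_contra hlt
    push Not at hlt
    have h1 : y = x - (x - y) := by ring
    have h2 : ‖y‖ < 1 := by
      rw [h1]
      have h3 := PadicAlgCl.isNonarchimedean p x (-(x - y))
      rw [norm_neg, ← sub_eq_add_neg] at h3
      exact h3.trans_lt (max_lt hlt h)
    rw [hy] at h2
    exact lt_irrefl _ h2

/-- **Algebraic integers of `ℚ̄_p` have norm at most one** (the valuation ring of `ℚ̄_p` is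
integrally closed and contains `ℤ`). [folklore] -/
private theorem mult_norm_le_one_of_isIntegral {x : PadicAlgCl p} (hx : IsIntegral ℤ x) :
    ‖x‖ ≤ 1 := by
  have hv := Valuation.integer.integers (Valued.v (R := PadicAlgCl p))
  have hx' : IsIntegral (Valued.v (R := PadicAlgCl p)).integer x := hx.tower_top
  have h := (hv.isIntegral_iff_v_le_one).mp hx'
  rw [PadicAlgCl.valuation_def] at h
  exact_mod_cast h

/-- An integer divisible by `p` has norm `< 1` in `ℚ̄_p`. [folklore] -/
private theorem mult_norm_intCast_lt_one_of_dvd {z : ℤ} (hz : (p : ℤ) ∣ z) :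
    ‖(z : PadicAlgCl p)‖ < 1 := by
  rw [← map_intCast (algebraMap ℚ_[p] (PadicAlgCl p)) z]
  change ‖((z : ℚ_[p]) : PadicAlgCl p)‖ < 1
  rw [PadicAlgCl.norm_extends]
  exact Padic.norm_intCast_lt_one_iff.2 hz

/-- A finite sum of elements of norm `< 1` has norm `< 1` (ultrametric inequality). [folklore] -/
private theorem mult_norm_sum_lt_one {α : Type*} (s : Finset α) (u : α → PadicAlgCl p)
    (h : ∀ a ∈ s, ‖u a‖ < 1) : ‖∑ a ∈ s, u a‖ < 1 := by
  rcases s.eq_empty_or_nonempty with rfl | hs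
  · simp
  · obtain ⟨a, ha, hle⟩ := IsUltrametricDist.exists_norm_finsetSum_le_of_nonempty hs u
    exact hle.trans_lt (h a ha)


end Norm

/-! ### Diamond operators and multiplication by a `Γ₀(N)`-invariant form -/

section MulForm

variable {N : ℕ} [NeZero N] {k w : ℤ}

/-- **Diamond operators commute with multiplication by a `Γ₀(N)`-invariant form**: if
`G ∈ M_w(Γ₁(N))` satisfies `G ∣[w] γ = G` for every `γ ∈ Γ₀(N)` (e.g. `G` comes from `M_w(Γ₀(N))`),
then `⟨d⟩ (f G) = (⟨d⟩ f) G` on `S_k(Γ₁(N))`: `⟨d⟩` is `F ↦ F ∣ γ_d` for a chosen `γ_d ∈ Γ₀(N)`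
(Diamond–Shurman §5.2; `coe_cuspHeckeOperatorₗ_gamma1`) and `(f G) ∣ γ_d = (f ∣ γ_d)(G ∣ γ_d)`; for a
non-unit `d` both diamond operators are the junk value `id` (cf. `diamondOp_mulModularForm_ofLevelOne`
for level-one `G`, `diamondOp_mulModularForm_of_slash_chi4` for character `χ₋₄`).
[cite: DiamondShurman2005, §5.2] -/
theorem diamondOp_mulModularForm_of_forall_slash_eq (G : ModularForm (Gamma1 N) w)
    (hG : ∀ γ : SL(2, ℤ), γ ∈ Gamma0 N → (⇑G : ℍ → ℂ) ∣[w] γ = ⇑G)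
    (d : ZMod N) (f : CuspForm (Gamma1 N) k) :
    diamondOp N (k + w) d (f.mulModularForm G) = (diamondOp N k d f).mulModularForm G := by
  unfold diamondOp
  split_ifs with h
  · apply DFunLike.coe_injective
    change ⇑(cuspHeckeOperatorₗ (Gamma1 N) (k + w) (slToGLPos h.choose) _) = _
    rw [coe_cuspHeckeOperatorₗ_gamma1, CuspForm.coe_mulModularForm, CuspForm.coe_mulModularForm]
    change _ = ⇑(cuspHeckeOperatorₗ (Gamma1 N) k (slToGLPos h.choose) f) * _
    rw [coe_cuspHeckeOperatorₗ_gamma1,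
      show (Matrix.SpecialLinearGroup.mapGL ℝ ((h.choose : Gamma0 N) : SL(2, ℤ)) :
          GL (Fin 2) ℝ) = (((h.choose : Gamma0 N) : SL(2, ℤ)) : GL (Fin 2) ℝ) from rfl,
      ← ModularForm.SL_slash, ← ModularForm.SL_slash, ModularForm.mul_slash_SL2,
      hG _ (h.choose).2]
  · rfl

end MulForm

/-! ### The Deligne–Serre step with an arbitrary multiplier `E ≡ 1 (mod 𝔪)` -/

section DeligneSerre

variable {p : ℕ} [Fact p.Prime]

set_option maxHeartbeats 1600000 in
/-- **Congruent newforms in higher weight through a multiplier `≡ 1 (mod 𝔪)` (Deligne–Serre).**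
Let `p` be a prime, `ι : ℚ̄_p ≃ ℂ`, `f ∈ S_{k₀}(Γ₀(N))` a newform of weight `k₀ ≥ 2`, `w` a natural
number divisible by `p − 1`, and `E ∈ M_w(Γ₁(N))` a modular form which is invariant under every
`γ ∈ Γ₀(N)` and whose `q`-expansion is `≡ 1` modulo the maximal ideal `𝔪` of `𝒪_{ℚ̄_p}` (read
through `ι⁻¹`): `a_0(E) = 1` and `|ι⁻¹ a_j(E)|_p < 1` for `j ≥ 1`.  Then there are a divisor `M ∣ N`
and a newform `g ∈ S_{k₀+w}(Γ₀(M))` with `a_q(g) ≡ a_q(f) (mod 𝔪)` for every prime `q ∤ N`.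
Proof (the tree's proof of `exists_isNewform0_dvd_level_congr`, with the level-one Eisenstein series
`E_w` replaced by `E`): `f · E ∈ S_{k₀+w}(Γ₁(N))` has trivial nebentypus
(`diamondOp_mulModularForm_of_forall_slash_eq`), `p`-integral coefficients congruent to those of `f`,
hence is an eigenvector MODULO `𝔪` of every `T_q` with eigenvalue `a_q(f)` (the weight enters the
`q`-expansion of `T_q` only through `q^{k-1}`, and `q^{k₀+w-1} ≡ q^{k₀-1} (mod p)` by Fermat since
`(p − 1) ∣ w`, both sides being `≡ 0` for `q = p` as `k₀ ≥ 2`); the Deligne–Serre lifting lemma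
(`DeligneSerreLift.exists_eigenform_of_congruence`) gives a genuine eigenform of level `N`, weight
`k₀ + w` and trivial character with congruent eigenvalues, and its eigenvalue packet away from `N` is
that of a newform of some level `M ∣ N` (Atkin–Lehner–Li, `exists_isNewform1_of_eigenpacket`).  With
`E = E_w` (`w ≥ 4` even) this is `exists_isNewform0_dvd_level_congr`; with the weight-two multiplier
`Φ_M/(1 − M)` below it reaches weight `k₀ + 2` at `p = 3`.
[cite: DeligneSerreASENS1974, 6.9–6.11] [cite: DiamondShurman2005, Thm. 5.8.2–5.8.3] -/
theorem exists_isNewform0_dvd_level_congr_of_multiplier (ι : PadicAlgCl p ≃+* ℂ) {N : ℕ}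
    [NeZero N] {k₀ : ℤ} (hk₀ : 2 ≤ k₀) {f : CuspForm (Gamma0 N) k₀} (hf : IsNewform0 f)
    {w : ℕ} (hpw : (p - 1) ∣ w) (E : ModularForm (Gamma1 N) (w : ℤ))
    (hEΓ : ∀ γ : SL(2, ℤ), γ ∈ Gamma0 N → (⇑E : ℍ → ℂ) ∣[(w : ℤ)] γ = ⇑E)
    (hE0 : (qExpansion 1 ⇑E).coeff 0 = 1)
    (hEnorm : ∀ j : ℕ, j ≠ 0 → ‖ι.symm ((qExpansion 1 ⇑E).coeff j)‖ < 1) :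
    ∃ (M : ℕ) (_ : NeZero M) (_ : M ∣ N) (g : CuspForm (Gamma0 M) (k₀ + w)),
      IsNewform0 g ∧
      ∀ q : ℕ, q.Prime → ¬ q ∣ N →
        ‖ι.symm ((qExpansion 1 ⇑g).coeff q) - ι.symm ((qExpansion 1 ⇑f).coeff q)‖ < 1 := by
  classical
  have hp : p.Prime := Fact.out
  have hK1 : (1 : ℤ) ≤ k₀ + w := by omega
  have h1N := HeckeTGamma1.one_mem_strictPeriods_Gamma1 N
  -- ### the form `x = f · E ∈ S_{k₀+w}(N, 𝟙)` (`E ≡ 1 (mod 𝔪)`, `Γ₀(N)`-invariant)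
  set f₁ : CuspForm (Gamma1 N) k₀ := liftToGamma1 N k₀ f with hf₁def
  have hf₁ : ∀ n, cuspCoeff f₁ n = (qExpansion 1 ⇑f).coeff n := fun n ↦ by
    change (qExpansion 1 ⇑(liftToGamma1 N k₀ f)).coeff n = _
    rw [coe_liftToGamma1_holds N k₀ f]
  let x : CuspForm (Gamma1 N) (k₀ + w) := f₁.mulModularForm E
  have hxq : qExpansion 1 ⇑x = qExpansion 1 ⇑f₁ * qExpansion 1 ⇑E := by
    change qExpansion 1 ⇑(f₁.mulModularForm E) = _
    rw [CuspForm.coe_mulModularForm]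
    exact ModularForm.qExpansion_mul_coe one_pos h1N f₁ E
  have hxmul : ∀ m, cuspCoeff x m = ∑ ij ∈ Finset.HasAntidiagonal.antidiagonal m,
      cuspCoeff f₁ ij.1 * (qExpansion 1 ⇑E).coeff ij.2 := fun m ↦ by
    change (qExpansion 1 ⇑x).coeff m = _
    rw [hxq, PowerSeries.coeff_mul]
    rfl
  -- ### norms: `a_n(f)` integral, `e_j ∈ 𝔪` for `j ≠ 0`
  set A : ℕ → PadicAlgCl p := fun n ↦ ι.symm ((qExpansion 1 ⇑f).coeff n) with hA
  have hAint : ∀ n, ‖A n‖ ≤ 1 := fun n ↦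
    mult_norm_le_one_of_isIntegral ((IsNewform0.isIntegral_coeff_holds hf n).map
      (ι.symm : ℂ →+* PadicAlgCl p).toIntAlgHom)
  -- ### `x ≡ f`: `‖ι⁻¹ a_m(x) - ι⁻¹ a_m(f)‖ < 1`, `‖ι⁻¹ a_m(x)‖ ≤ 1`, `a_1(x) ≡ 1`
  have hxf : ∀ m, ‖ι.symm (cuspCoeff x m) - A m‖ < 1 := by
    intro m
    have hmem : (m, 0) ∈ Finset.HasAntidiagonal.antidiagonal m := by simp
    rw [hxmul, ← Finset.add_sum_erase _ _ hmem, hE0, mul_one, hf₁, map_add, hA,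
      add_sub_cancel_left, map_sum]
    refine mult_norm_sum_lt_one _ _ fun ij hij ↦ ?_
    obtain ⟨hne, hij'⟩ := Finset.mem_erase.mp hij
    have hj : ij.2 ≠ 0 := by
      intro h
      apply hne
      have := Finset.HasAntidiagonal.mem_antidiagonal.mp hij'
      rw [h, add_zero] at this
      exact Prod.ext this h
    rw [map_mul, hf₁, norm_mul]
    exact mul_lt_one_of_nonneg_of_lt_one_right (hAint _) (norm_nonneg _) (hEnorm _ hj)
  have hxint : ∀ m, ‖ι.symm (cuspCoeff x m)‖ ≤ 1 := fun m ↦ by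
    have h1 : ι.symm (cuspCoeff x m) = (ι.symm (cuspCoeff x m) - A m) + A m := by ring
    rw [h1]
    exact (PadicAlgCl.isNonarchimedean p _ _).trans (max_le (hxf m).le (hAint m))
  have hA1 : A 1 = 1 := by
    rw [hA]
    change ι.symm ((qExpansion 1 ⇑f).coeff 1) = 1
    rw [show (qExpansion 1 ⇑f).coeff 1 = 1 from hf.2.2, map_one]
  have hx1 : ‖ι.symm (cuspCoeff x 1)‖ = 1 :=
    mult_norm_eq_one_of_norm_sub_lt_one (y := A 1) (by rw [hA1, norm_one]) (hxf 1)
  -- ### `x ∈ S_{k₀+w}(N, 𝟙)`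
  have hxW : x ∈ nebentypusSubspace N (k₀ + w) 1 := by
    rw [mem_nebentypusSubspace_iff_diamondOp]
    intro d
    change diamondOp N (k₀ + (w : ℤ)) d (f₁.mulModularForm E) = _
    rw [diamondOp_mulModularForm_of_forall_slash_eq E hEΓ (d : ZMod N) f₁, hf₁def,
      diamondOp_liftToGamma1 N k₀ (d : ZMod N) f, MulChar.one_apply_coe, one_smul]
  have hxdiam : ∀ d : (ZMod N)ˣ, diamondOp N (k₀ + w) (d : ZMod N) x = x := fun d ↦ by
    have h := (mem_nebentypusSubspace_iff_diamondOp.mp hxW) d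
    rwa [MulChar.one_apply_coe, one_smul] at h
  -- ### the Hecke relations of `f` (Diamond–Shurman Prop. 5.8.5) read in `ℚ̄_p`
  -- exponents: `k₀ - 1 = e₀`, `k₀ + w - 1 = e₀ + w`
  obtain ⟨e₀, he₀⟩ : ∃ e₀ : ℕ, k₀ - 1 = (e₀ : ℤ) := ⟨(k₀ - 1).toNat, by omega⟩
  have he₀1 : 1 ≤ e₀ := by omega
  have hzpow₀ : ∀ q : ℕ, (q : ℂ) ^ (k₀ - 1) = ((q ^ e₀ : ℕ) : ℂ) := fun q ↦ by
    rw [he₀, zpow_natCast, Nat.cast_pow]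
  have hzpow : ∀ q : ℕ, (q : ℂ) ^ (k₀ + (w : ℤ) - 1) = ((q ^ (e₀ + w) : ℕ) : ℂ) := fun q ↦ by
    rw [show k₀ + (w : ℤ) - 1 = ((e₀ + w : ℕ) : ℤ) by push_cast; omega, zpow_natCast,
      Nat.cast_pow]
  -- `p ∣ q^{e₀+w} - q^{e₀}` for every prime `q`
  have hdvd : ∀ q : ℕ, q.Prime → (p : ℤ) ∣ ((q ^ (e₀ + w) : ℕ) : ℤ) - ((q ^ e₀ : ℕ) : ℤ) := by
    intro q hq
    have hfac : ((q ^ (e₀ + w) : ℕ) : ℤ) - ((q ^ e₀ : ℕ) : ℤ) =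
        (q : ℤ) ^ e₀ * ((q : ℤ) ^ w - 1) := by push_cast; ring
    rw [hfac]
    by_cases hqp : q = p
    · subst hqp
      exact Dvd.dvd.mul_right (dvd_pow_self (q : ℤ) (by omega)) _
    · apply Dvd.dvd.mul_left
      have hcop : IsCoprime (q : ℤ) p := by
        rw [Nat.isCoprime_iff_coprime]
        exact (Nat.coprime_primes hq hp).2 hqp
      obtain ⟨c, hc⟩ := hpw
      have h1 : (q : ℤ) ^ (p - 1) ≡ 1 [ZMOD p] := Int.ModEq.pow_card_sub_one_eq_one hp hcop
      have h2 : (q : ℤ) ^ w ≡ 1 [ZMOD p] := by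
        rw [hc, pow_mul]
        simpa using h1.pow c
      exact (Int.ModEq.dvd h2.symm)
  have hpowdiff : ∀ q : ℕ, q.Prime →
      ‖ι.symm (((q ^ (e₀ + w) : ℕ) : ℂ)) - ι.symm (((q ^ e₀ : ℕ) : ℂ))‖ < 1 := by
    intro q hq
    rw [map_natCast, map_natCast]
    have h := mult_norm_intCast_lt_one_of_dvd (hdvd q hq)
    push_cast at h ⊢
    exact h
  have hpownorm : ∀ q : ℕ, ‖ι.symm (((q ^ (e₀ + w) : ℕ) : ℂ))‖ ≤ 1 := fun q ↦ by
    rw [map_natCast, ← Int.cast_natCast]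
    exact DeligneSerreLift.norm_intCast_le_one _
  -- ### `(B)` `x` is an eigenvector modulo `𝔪` of every `T_q`, with eigenvalue `a_q(f)`
  have hcongT : ∀ (q : ℕ) (hq : q.Prime) (n : ℕ),
      ‖ι.symm (cuspCoeff ((haveI : NeZero q := ⟨hq.ne_zero⟩;
          heckeT (Gamma1 N) (k₀ + w) q) x) n) - A q * ι.symm (cuspCoeff x n)‖ < 1 := by
    intro q hq n
    haveI : NeZero q := ⟨hq.ne_zero⟩
    -- `T_q` on `x` (weight `k₀ + w`)
    have hTx := cuspCoeff_heckeT_gamma1 x q hq n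
    -- the relation `a_{qn}(f) = a_q a_n - …` (weight `k₀`)
    have hrel := IsNewform0.coeff_prime_mul hf hq n
    set D : ℕ → PadicAlgCl p := fun m ↦ ι.symm (cuspCoeff x m) - A m with hD
    have hDlt : ∀ m, ‖D m‖ < 1 := hxf
    have hxD : ∀ m, ι.symm (cuspCoeff x m) = A m + D m := fun m ↦ by rw [hD]; ring
    by_cases hqN : q ∣ N
    · rw [if_pos hqN, add_zero] at hTx
      rw [if_pos hqN, sub_zero] at hrel
      -- `ι⁻¹ a_n(T_q x) - A q ι⁻¹ a_n(x) = D(qn) - A q D n`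
      have e1 : ι.symm (cuspCoeff (heckeT (Gamma1 N) (k₀ + ↑w) q x) n) -
          A q * ι.symm (cuspCoeff x n) = D (q * n) - A q * D n := by
        rw [hTx, hxD, hxD n]
        have : A (q * n) = A q * A n := by
          simp only [hA]
          rw [hrel, map_mul]
        rw [this]
        ring
      rw [e1]
      refine (mult_norm_sub_le_maxAux _ _).trans_lt (max_lt (hDlt _) ?_)
      rw [norm_mul]
      exact mul_lt_one_of_nonneg_of_lt_one_right (hAint q) (norm_nonneg _) (hDlt n)
    · rw [if_neg hqN] at hTx hrel
      obtain ⟨d, hd⟩ := (ZMod.isUnit_prime_iff_not_dvd hq).mpr hqN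
      have hdiag : diamondOp N (k₀ + w) (q : ZMod N) x = x := by rw [← hd]; exact hxdiam d
      rw [hdiag, hzpow q] at hTx
      rw [hzpow₀ q] at hrel
      by_cases hqn : q ∣ n
      · rw [if_pos hqn] at hTx hrel
        have e1 : ι.symm (cuspCoeff (heckeT (Gamma1 N) (k₀ + ↑w) q x) n) -
            A q * ι.symm (cuspCoeff x n) =
            D (q * n) - A q * D n +
              (ι.symm (((q ^ (e₀ + w) : ℕ) : ℂ)) * D (n / q) +
                (ι.symm (((q ^ (e₀ + w) : ℕ) : ℂ)) - ι.symm (((q ^ e₀ : ℕ) : ℂ))) *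
                  A (n / q)) := by
          rw [hTx, map_add, map_mul, hxD, hxD n, hxD (n / q)]
          have : A (q * n) = A q * A n - ι.symm (((q ^ e₀ : ℕ) : ℂ)) * A (n / q) := by
            simp only [hA]
            rw [hrel, map_sub, map_mul, map_mul]
          rw [this]
          ring
        rw [e1]
        refine (PadicAlgCl.isNonarchimedean p _ _).trans_lt (max_lt ?_ ?_)
        · refine (mult_norm_sub_le_maxAux _ _).trans_lt (max_lt (hDlt _) ?_)
          rw [norm_mul]
          exact mul_lt_one_of_nonneg_of_lt_one_right (hAint q) (norm_nonneg _) (hDlt n)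
        · refine (PadicAlgCl.isNonarchimedean p _ _).trans_lt (max_lt ?_ ?_)
          · rw [norm_mul]
            exact mul_lt_one_of_nonneg_of_lt_one_right (hpownorm q) (norm_nonneg _) (hDlt _)
          · rw [norm_mul]
            exact mul_lt_one_of_nonneg_of_lt_one_left (norm_nonneg _) (hpowdiff q hq)
              (hAint _)
      · rw [if_neg hqn, mul_zero, add_zero] at hTx
        rw [if_neg hqn, mul_zero, sub_zero] at hrel
        have e1 : ι.symm (cuspCoeff (heckeT (Gamma1 N) (k₀ + ↑w) q x) n) -
            A q * ι.symm (cuspCoeff x n) = D (q * n) - A q * D n := by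
          rw [hTx, hxD, hxD n]
          have : A (q * n) = A q * A n := by
            simp only [hA]
            rw [hrel, map_mul]
          rw [this]
          ring
        rw [e1]
        refine (mult_norm_sub_le_maxAux _ _).trans_lt (max_lt (hDlt _) ?_)
        rw [norm_mul]
        exact mul_lt_one_of_nonneg_of_lt_one_right (hAint q) (norm_nonneg _) (hDlt n)
  -- ### `(C)` Deligne–Serre lifting inside `S_{k₀+w}(N, 𝟙)`
  let TL : ℕ → Module.End ℂ (CuspForm (Gamma1 N) (k₀ + w)) := fun q ↦
    if hq : q = 0 then 0 else (haveI : NeZero q := ⟨hq⟩; heckeT (Gamma1 N) (k₀ + w) q)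
  have hTL : ∀ (q : ℕ) (hq : q ≠ 0),
      TL q = (haveI : NeZero q := ⟨hq⟩; heckeT (Gamma1 N) (k₀ + w) q) := fun q hq ↦ dif_neg hq
  let 𝒯 : Set (Module.End ℂ (CuspForm (Gamma1 N) (k₀ + w))) :=
    {T | ∃ q : ℕ, q.Prime ∧ T = TL q}
  have hcomm : ∀ S ∈ 𝒯, ∀ T ∈ 𝒯, Commute S T := by
    rintro S ⟨q, hq, rfl⟩ T ⟨q', hq', rfl⟩
    rw [hTL q hq.ne_zero, hTL q' hq'.ne_zero]
    haveI : NeZero q := ⟨hq.ne_zero⟩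
    haveI : NeZero q' := ⟨hq'.ne_zero⟩
    exact heckeT_comm_holds N (k₀ + w) q q'
  have hdiam : ∀ T ∈ 𝒯, ∀ d : (ZMod N)ˣ,
      Commute T (diamondOp N (k₀ + w) (d : ZMod N)) := by
    rintro T ⟨q, hq, rfl⟩ d
    rw [hTL q hq.ne_zero]
    haveI : NeZero q := ⟨hq.ne_zero⟩
    exact heckeT_diamondOp_comm_holds N (k₀ + w) q (d : ZMod N)
  have hΛ : ∀ T ∈ 𝒯, ∀ y ∈ integralLattice1 N (k₀ + w), T y ∈ integralLattice1 N (k₀ + w) := by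
    rintro T ⟨q, hq, rfl⟩ y hy
    rw [hTL q hq.ne_zero]
    haveI : NeZero q := ⟨hq.ne_zero⟩
    exact heckeT_mem_integralLattice1 hK1 hy q hq
  -- the targets: any admissible congruence class (they are unique modulo `𝔪`)
  let P : Module.End ℂ (CuspForm (Gamma1 N) (k₀ + w)) → PadicAlgCl p → Prop := fun T c ↦
    ‖c‖ ≤ 1 ∧ ∀ n, ‖ι.symm (cuspCoeff (T x) n) - c * ι.symm (cuspCoeff x n)‖ < 1
  let a : Module.End ℂ (CuspForm (Gamma1 N) (k₀ + w)) → PadicAlgCl p := fun T ↦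
    if h : ∃ c, P T c then h.choose else 0
  have haP : ∀ T c, P T c → P T (a T) := by
    intro T c hc
    have h : ∃ c, P T c := ⟨c, hc⟩
    simp only [a, dif_pos h]
    exact h.choose_spec
  have hPuniq : ∀ T c₁ c₂, P T c₁ → P T c₂ → ‖c₁ - c₂‖ < 1 := by
    intro T c₁ c₂ h₁ h₂
    have h := mult_norm_sub_lt_one_trans (by rw [← norm_neg, neg_sub]; exact h₁.2 1) (h₂.2 1)
    rw [← sub_mul, norm_mul, hx1, mul_one] at h
    exact h
  have hPT : ∀ (q : ℕ) (hq : q.Prime), P (TL q) (A q) := by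
    intro q hq
    refine ⟨hAint q, fun n ↦ ?_⟩
    rw [hTL q hq.ne_zero]
    exact hcongT q hq n
  have ha : ∀ T ∈ 𝒯, ‖a T‖ ≤ 1 := by
    intro T hT
    by_cases h : ∃ c, P T c
    · exact (haP T _ h.choose_spec).1
    · simp only [a, dif_neg h, norm_zero]; exact zero_le_one
  have hcongr : ∀ T ∈ 𝒯, ∀ n,
      ‖ι.symm (cuspCoeff (T x) n) - a T * ι.symm (cuspCoeff x n)‖ < 1 := by
    rintro T ⟨q, hq, rfl⟩ n
    exact (haP _ _ (hPT q hq)).2 n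
  have hm : ¬ p ∣ 1 := hp.not_dvd_one
  have hχm : (1 : DirichletCharacter ℂ N) ^ 1 = 1 := pow_one 1
  obtain ⟨g₁, a', hg₁0, hg₁χ, hTg⟩ := DeligneSerreLift.exists_eigenform_of_congruence ι hK1 hm hχm
    𝒯 hcomm hdiam hΛ a ha hxW hxint hx1 hcongr
  -- eigenvalues of `g₁`
  have hmemT : ∀ (q : ℕ), q.Prime → TL q ∈ 𝒯 := fun q hq ↦ ⟨q, hq, rfl⟩
  have ha'T : ∀ (q : ℕ), q.Prime → ‖a' (TL q) - A q‖ < 1 := by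
    intro q hq
    have h1 := (hTg _ (hmemT q hq)).2.1
    have h2 := hPuniq _ _ _ (haP _ _ (hPT q hq)) (hPT q hq)
    exact mult_norm_sub_lt_one_trans h1 h2
  have hT : ∀ (q : ℕ) (hq : q.Prime), ¬ q ∣ N →
      (haveI : NeZero q := ⟨hq.ne_zero⟩; heckeT (Gamma1 N) (k₀ + w) q) g₁ =
        ι (a' (TL q)) • g₁ := by
    intro q hq _
    rw [← hTL q hq.ne_zero]
    exact (hTg _ (hmemT q hq)).2.2
  -- ### `(D)` the newform behind `g₁` (Atkin–Lehner–Li), on `Γ₀`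
  obtain ⟨M, _, hMN, g₀, hg₀new, hg₀q, hg₀χ⟩ :=
    exists_isNewform1_of_eigenpacket hg₁0 hg₁χ (a := fun q ↦ ι (a' (TL q))) hT
  have hneb : nebentypus g₀ = 1 := by
    apply DirichletCharacter.changeLevel_injective hMN
    rw [hg₀χ, map_one]
  have hg₀diam : ∀ d : ZMod M, IsUnit d → diamondOp M (k₀ + w) d g₀ = g₀ := by
    intro d hd
    obtain ⟨u, rfl⟩ := hd
    have h := (mem_nebentypusSubspace_iff_diamondOp.mp
      (IsNewform1.mem_nebentypusSubspace_nebentypus_holds hg₀new)) u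
    rwa [hneb, MulChar.one_apply_coe, one_smul] at h
  obtain ⟨g, hg⟩ := exists_liftToGamma1_eq_of_forall_diamondOp_eq (k₀ + w) g₀ hg₀diam
  have hgnew : IsNewform0 g := by
    rw [← isNewform1_liftToGamma1_iff_holds (N := M) (k := k₀ + w) g, hg]
    exact hg₀new
  refine ⟨M, inferInstance, hMN, g, hgnew, fun q hq hqN ↦ ?_⟩
  have hcoeff : (qExpansion 1 ⇑g).coeff q = cuspCoeff g₀ q := by
    rw [← hg]
    change _ = (qExpansion 1 ⇑(liftToGamma1 M (k₀ + w) g)).coeff q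
    rw [coe_liftToGamma1_holds M (k₀ + w) g]
  rw [hcoeff, hg₀q q hq hqN, RingEquiv.symm_apply_apply]
  exact ha'T q hq

end DeligneSerre

end Literature.NumberTheory.EllipticCurves.ModularForms

end
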